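import Literature.AlgebraicGeometry.Resolution.BlowupsFlatBaseChange
import Literature.AlgebraicGeometry.Resolution.AffineBlowup
import Mathlib.RingTheory.Spectrum.Prime.Chevalley
import Mathlib.RingTheory.Ideal.GoingDown
import Mathlib.RingTheory.RingHom.Flat
import Mathlib.RingTheory.Localization.Away.Basic
import Mathlib.AlgebraicGeometry.Morphisms.Flat
import HarnessLib

/-!
# Crux `FrobeniusLadder.FRationalResolution` (stmt-ResolutionOfSingularities-15317), line `redirect`,
# stub `stub_diagonalizableQuotientResolution` — shrinking an étale chart to a flat COVER of a basic open

Brick T3-c of the repair census (transfer of an `𝔪`-primary regular blow-up from an étale chart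
`Spec C → Spec B ⊆ X` down to `X` at an isolated singular point `𝔭`). After the centre has been descended
(`…PrimaryDescent.lean`) and regularity has been reduced to a flat SURJECTIVE cover (`…BlowupFlatCriteria.lean`),
one needs a basic open `D(h) ∋ 𝔭` of `Spec B` over which the (flat, finitely presented) chart is surjective, and the
bookkeeping of the localized rings:

* `exists_basicOpen_subset_range_comap` — the image of `Spec C → Spec B` (flat + finitely presented ⇒ OPEN,
  Chevalley/going-down, Stacks 00I1) contains a basic open `D(h)` around each of its points;
* `comap_awayMap_surjective` — then `Spec C_h → Spec B_h` is surjective;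
* `flat_awayMap` — and flat (`RingHom.Flat` is preserved by localization away);
* `mem_regularLocus_away_iff`, `eq_of_map_le_of_pow_le` — the regular locus and the point `𝔭` seen in `Spec B_h`
  (open immersion: stalks agree; a `𝔭`-primary ideal stays supported at the one point over `𝔭`).

Honest label: plumbing (no stub closed). No definitions, no named facts, no sorry.
[folklore; cite: StacksProject, Tag 00I1; GortzWedhorn2020, Prop. 13.91]
-/

noncomputable section

-- single-problem summit: the doubled namespace component is forced
set_option linter.dupNamespace false

open CategoryTheory AlgebraicGeometry TopologicalSpace
open Literature.AlgebraicGeometry.Resolution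

namespace Summit.ResolutionOfSingularities.ResolutionOfSingularities.Theorems.FRationalResolution.FlatCoverLocalization

universe u

variable (B C : Type u) [CommRing B] [CommRing C] [Algebra B C]

/-- **The image of a flat finitely presented `Spec C → Spec B` contains a basic open neighbourhood of each of its
points** (the image is open: going-down for flat algebras + Chevalley, Stacks 00I1). [cite: StacksProject, Tag 00I1] -/
theorem exists_basicOpen_subset_range_comap [Module.Flat B C] [Algebra.FinitePresentation B C]
    (𝔭 : PrimeSpectrum B) (h𝔭 : 𝔭 ∈ Set.range (PrimeSpectrum.comap (algebraMap B C))) :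
    ∃ h : B, h ∉ 𝔭.asIdeal ∧
      (PrimeSpectrum.basicOpen h : Set (PrimeSpectrum B)) ⊆ Set.range (PrimeSpectrum.comap (algebraMap B C)) := by
  have hopen : IsOpenMap (PrimeSpectrum.comap (algebraMap B C)) :=
    PrimeSpectrum.isOpenMap_comap_of_hasGoingDown_of_finitePresentation
  have hU : IsOpen (Set.range (PrimeSpectrum.comap (algebraMap B C))) := hopen.isOpen_range
  obtain ⟨_, ⟨h, rfl⟩, h𝔭h, hsub⟩ :=
    PrimeSpectrum.isTopologicalBasis_basic_opens.exists_subset_of_mem_open h𝔭 hU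
  exact ⟨h, (PrimeSpectrum.mem_basicOpen _ _).mp h𝔭h, hsub⟩

/-- **Surjectivity after localizing**: if `D(h) ⊆ im(Spec C → Spec B)` then `Spec C_h → Spec B_h` is surjective
(for any localizations `B_h`, `C_h` away from `h`, resp. its image). [folklore] -/
theorem comap_awayMap_surjective (h : B)
    (hsub : (PrimeSpectrum.basicOpen h : Set (PrimeSpectrum B)) ⊆
      Set.range (PrimeSpectrum.comap (algebraMap B C)))
    (B' C' : Type u) [CommRing B'] [CommRing C'] [Algebra B B'] [Algebra C C']
    [IsLocalization.Away h B'] [IsLocalization.Away (algebraMap B C h) C'] :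
    Function.Surjective
      (PrimeSpectrum.comap (IsLocalization.Away.map B' C' (algebraMap B C) h)) := by
  intro P'
  have hP : PrimeSpectrum.comap (algebraMap B B') P' ∈ PrimeSpectrum.basicOpen h := by
    have : PrimeSpectrum.comap (algebraMap B B') P' ∈
        Set.range (PrimeSpectrum.comap (algebraMap B B')) := ⟨P', rfl⟩
    rw [PrimeSpectrum.localization_away_comap_range B' h] at this
    exact this
  obtain ⟨Q, hQ⟩ := hsub hP
  have hQh : Q ∈ PrimeSpectrum.basicOpen (algebraMap B C h) := by
    rw [PrimeSpectrum.mem_basicOpen]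
    intro hmem
    have hh : h ∈ (PrimeSpectrum.comap (algebraMap B C) Q).asIdeal := hmem
    rw [hQ] at hh
    exact (PrimeSpectrum.mem_basicOpen _ _).mp hP hh
  obtain ⟨Q', hQ'⟩ : Q ∈ Set.range (PrimeSpectrum.comap (algebraMap C C')) := by
    rw [PrimeSpectrum.localization_away_comap_range C' (algebraMap B C h)]
    exact hQh
  refine ⟨Q', PrimeSpectrum.localization_comap_injective B' (Submonoid.powers h) ?_⟩
  have key : PrimeSpectrum.comap (algebraMap B B')
      (PrimeSpectrum.comap (IsLocalization.Away.map B' C' (algebraMap B C) h) Q') =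
      PrimeSpectrum.comap (algebraMap B C) (PrimeSpectrum.comap (algebraMap C C') Q') := by
    ext1
    change Ideal.comap (algebraMap B B') (Ideal.comap _ Q'.asIdeal) =
      Ideal.comap (algebraMap B C) (Ideal.comap _ Q'.asIdeal)
    rw [Ideal.comap_comap, Ideal.comap_comap, IsLocalization.Away.map, IsLocalization.map_comp]
  change PrimeSpectrum.comap (algebraMap B B')
      (PrimeSpectrum.comap (IsLocalization.Away.map B' C' (algebraMap B C) h) Q') =
    PrimeSpectrum.comap (algebraMap B B') P'
  rw [key, hQ', hQ]

/-- **Flatness after localizing**: `B_h → C_h` is flat if `B → C` is. [folklore] -/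
theorem flat_awayMap (hflat : (algebraMap B C).Flat) (h : B)
    (B' C' : Type u) [CommRing B'] [CommRing C'] [Algebra B B'] [Algebra C C']
    [IsLocalization.Away h B'] [IsLocalization.Away (algebraMap B C h) C'] :
    (IsLocalization.Away.map B' C' (algebraMap B C) h).Flat :=
  RingHom.Flat.propertyIsLocal.localizationAwayPreserves (algebraMap B C) h B' C' hflat

variable {B}

/-- **The regular locus of a basic open**: along the open immersion `Spec B_h → Spec B` a point is regular iff
its image is. [folklore] -/
theorem mem_regularLocus_away_iff (h : B) (B' : Type u) [CommRing B'] [Algebra B B']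
    [IsLocalization.Away h B'] (t : Spec (.of B')) :
    t ∈ Scheme.regularLocus (Spec (.of B')) ↔
      Spec.map (CommRingCat.ofHom (algebraMap B B')) t ∈ Scheme.regularLocus (Spec (.of B)) := by
  haveI : IsOpenImmersion (Spec.map (CommRingCat.ofHom (algebraMap B B'))) :=
    IsOpenImmersion.of_isLocalization h
  exact mem_regularLocus_iff_of_flat_of_isPreimmersion _ t

/-- **A `𝔭`-primary ideal (`𝔭` maximal) stays supported at the single point over `𝔭` after localizing away
from `h ∉ 𝔭`**: if `𝔭ⁿ ≤ I` and `I B_h ≤ 𝔱` for a prime `𝔱` of `B_h`, then `𝔱` is the prime over `𝔭`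
(`𝔱 ∩ B = 𝔭`). [folklore] -/
theorem comap_eq_of_map_le_of_pow_le (h : B) (B' : Type u) [CommRing B'] [Algebra B B']
    [IsLocalization.Away h B'] (𝔭 : Ideal B) [𝔭.IsMaximal] (I : Ideal B) {n : ℕ} (hpI : 𝔭 ^ n ≤ I)
    (𝔱 : Ideal B') [𝔱.IsPrime] (ht : I.map (algebraMap B B') ≤ 𝔱) :
    𝔱.comap (algebraMap B B') = 𝔭 := by
  haveI hprime : (𝔱.comap (algebraMap B B')).IsPrime := Ideal.comap_isPrime _ 𝔱
  have h1 : 𝔭 ^ n ≤ 𝔱.comap (algebraMap B B') := hpI.trans (Ideal.map_le_iff_le_comap.mp ht)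
  have hle : 𝔭 ≤ 𝔱.comap (algebraMap B B') :=
    fun x hx => hprime.mem_of_pow_mem n (h1 (Ideal.pow_mem_pow hx n))
  exact (Ideal.IsMaximal.eq_of_le inferInstance hprime.ne_top hle).symm

end Summit.ResolutionOfSingularities.ResolutionOfSingularities.Theorems.FRationalResolution.FlatCoverLocalization

end
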